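import Mathlib
import Literature.NumberTheory.EllipticCurves.CanonicalPAdicHeightIntegralityBoundedIndexProofs
import Literature.NumberTheory.EllipticCurves.TamagawaFiniteIndexProofs
import HarnessLib

/-!
# CanonicalPAdicHeightValueSubgroup

Topic `Literature/NumberTheory/EllipticCurves`. Named literature fact(s) relocated by the gate from `Summits/BirchSwinnertonDyer/BirchSwinnertonDyer/Theorems/SlopeDichotomyA2DegenerateLocusA2ValueSubgroup.lean`
(accept-time relocation of `[cite]`d propositions written inline in a Summits proposal; human ruling 2026-08-15).
Sources: MazurSteinTate2006, MazurTate1983Biext.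

* `Literature.NumberTheory.EllipticCurves.canonicalPAdicHeight_norm_le_valueSubgroup`
-/

namespace Literature.NumberTheory.EllipticCurves

open scoped Classical MatrixGroups ModularForm
open PowerSeries CongruenceSubgroup WeierstrassCurve Literature.NumberTheory.EllipticCurves

/-- **Mazur–Tate 1983, §3.3 value subgroup / (4.1.1)–(4.1.2), with (4.4) Prop. — THE canonical cyclotomic
`p`-adic height pairing of `E/ℚ` takes values in `p^{1−ν}ℤ_p`, `ν = max(max_ℓ ord_p m_ℓ, 2·ord_p n_p)`.**
Printed: for paired abelian varieties `A, B` over a global field `K` and an admissible `ρ = (ρ_v)` ramified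
exactly on the finite set `S` (where `A` is ordinary), the canonical `ρ`-pairing (Definition (3.2): the local
splittings are the CANONICAL `ρ_v`-splittings of the biextension, Theorem 1.5) takes values in
`Σ_{v∈𝒱_∞} ρ_v(K_v^*) + Σ_{v∈S} (1/m_{A_v})[ρ_v(K_v^*) + (1/(m_{B_v} n_{A_v} n_{B_v})) ρ_v(𝔬_v^*)] + Σ_{v∉S,𝒱_∞} (1/m_{A_v}) ρ_v(K_v^*)`
(§3.3, display after (3.3.4); `p`-adic form (4.1.1)–(4.1.2): `(a,b)_ρ ∈ p^{−ν}·ρ(𝔸_K^*)`), where (§1.2)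
`m_{A_v}` is the EXPONENT of `A₀(k_v)/A₀⁰(k_v)` (the `k_v`-rational component group of the Néron model) and
`n_{A_v}` the exponent of `A₀⁰(k_v)/T_A(k_v)`; and ((4.4) Prop.) Schneider's `p`-adic analytic height equals the
canonical `ρ_c`-pairing for `ρ_c(σ) = log_p u(σ)`, `ζ^σ = ζ^{u(σ)}`. Read for an elliptic curve `E/ℚ` with globally
minimal equation `W`, `A = B = E` (principally polarised), `ρ = ρ_c` and an odd prime `p` of good ORDINARY
reduction: `S = {p}`, `m_p = 1` and `T = 0`, `n_p` = exponent of `Ẽ(𝔽_p)` DIVIDES `#Ẽ(𝔽_p)`, `m_ℓ` DIVIDES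
`c_ℓ = #Φ_ℓ(𝔽_ℓ) = [E(ℚ_ℓ) : E⁰(ℚ_ℓ)]` DIVIDES `∏_ℓ c_ℓ`, `ρ_ℓ(ℚ_ℓ^*) = ℤ·log_p ℓ ⊆ pℤ_p` (`χ_cyc` unramified at
`ℓ ≠ p`, `χ_cyc(Frob_ℓ) = ℓ`) and `ρ_p(ℚ_p^*) = ρ_c(𝔸_ℚ^*) = log_p(ℤ_p^×) = pℤ_p`; and the pairing is THE datum
the tree pins by the sigma formula (`WeierstrassCurve.PAdicHeightData.IsCanonical`: `⟨P,P⟩ = log_p den x(P) −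
2 log_p σ_p(z(P))` on admissible points `= −2p·h_p` of Mazur–Stein–Tate 2006 §1 `= (P,P)_{ρ_c}`, MST §1 fn. 1 and
§2.7–2.8; the normalisation of the landed facts `canonicalPAdicHeight_isogeny_adjoint` and of the PROVED corners
`WeierstrassCurve.norm_pairing_le_of_not_anomalous` / `…_of_not_dvd_index` of this very display). Statement
(weakened from exponents to orders, which only enlarges the printed value group): for globally minimal elliptic
`W/ℚ`, an odd prime `p` of good ordinary reduction, THE canonical datum `D` and all `P, Q ∈ E(ℚ)`,
`‖D.pairing P Q‖ ≤ p^{max(ord_p ∏_ℓ c_ℓ, 2·ord_p #Ẽ(𝔽_p)) − 1}`. Named fact (D-0014): nothing is asserted; users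
take `(h : canonicalPAdicHeight_norm_le_valueSubgroup)`.
-- TODO(general form): the printed statement has the EXPONENTS `m_ℓ` of `Φ_ℓ(𝔽_ℓ)` and `n_p` of `Ẽ(𝔽_p)` (not the
-- orders `c_ℓ`, `#Ẽ(𝔽_p)`), a number field `K`, paired abelian varieties and any admissible `ρ`; the tree has no
-- `ℚ_ℓ`-rational component group or local `p`-adic height yet.
[cite: MazurTate1983Biext, §3.3 (display after (3.3.4)) and (4.1.1)–(4.1.2), with §1.2 (exponents `m_A`, `n_A`), Definition (3.2) and (4.4) Prop. (Schneider's height = canonical `ρ_c`-pairing)]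
[cite: MazurSteinTate2006, §1 (eq. (1.1) and footnote 1) and §2.7–2.8 (cyclotomic `p`-adic height `h_ρ = −½(·,·)_ρ`)]
[file NumberTheory/EllipticCurves/CanonicalPAdicHeightValueSubgroup] -/
def canonicalPAdicHeight_norm_le_valueSubgroup : Prop :=
  ∀ (W : WeierstrassCurve ℚ) [W.IsElliptic] [W.IsGloballyMinimal] (p : ℕ) [Fact p.Prime], p ≠ 2 →
    W.HasGoodReductionAtPrime p → ¬ (p : ℤ) ∣ W.frobeniusTrace p →
    ∀ (D : WeierstrassCurve.PAdicHeightData W p), D.IsCanonical →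
    ∀ (P Q : W.toAffine.Point),
      ‖D.pairing P Q‖ ≤ (p : ℝ) ^ ((max (padicValNat p W.tamagawaProduct)
        (2 * padicValNat p (W.reductionPointCount p)) : ℤ) - 1)

end Literature.NumberTheory.EllipticCurves
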